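import Literature.AnabelianGeometry.EtaleTheta.Discharge.Sec4Prop42SubIvHolds
import Literature.AnabelianGeometry.EtaleTheta.Discharge.Sec4Prop42SubZetaA
import Literature.AnabelianGeometry.EtaleTheta.Discharge.Sec3Thm37SubQFT
import HarnessLib

/-!
# [EtTh] Prop. 4.2 (iv) AS TYPED follows from L06 `ZetaA` for EVERY §4 setting (dictionary binders dropped)

Mochizuki, *The étale theta function and its Frobenioid-theoretic manifestations*, Publ. RIMS **45**
(2009) [EtTh], §4, Proposition 4.2 (iv), PDF p.89 (statement), p.90 L12–24 (proof)
[cite: MochizukiEtTh2009, Prop 4.2 p.89].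

PROOF-ONLY companion (abc-iut cell, block F, seat abc-iut-f-131; sub-DAG `plan/L2/SUBDAG-EtTh-Prop42.md`
row EtTh:Prop4.2(iv)/L00 `Assembly_iv`).  Nothing landed is edited or restated; no `def`, no named fact,
no instance.  With L07′ `RootUnitTorsion` and L08 `BetaCompat` now THEOREMS for every setting
(`Prop42Sub.rootUnitTorsion_holds`, `betaCompat_holds`, `Sec4Prop42SubIvHolds.lean`), abc-iut-w5-d134's
sharper composition `prop42_iv_of_zetaA_of_rootUnitTorsion` loses its torsion input, and the birational
DICTIONARY binders (`toB`, `hfrac`, `hpull`) of `prop42_iv_of_zetaA` / `prop42_iv_of_unitRootsUpstairs`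
become idle:

* `prop42_iv_of_isDivisorial_of_zetaA` — for EVERY setting `S` (every vocabulary `VD`) and EVERY transport
  `pullFrac`: the typed node `BiKummerSetting.Prop42_iv` follows from L06 `ZetaA` modulo «`Φ` divisorial»
  ONLY (the law still enters through L07's isomorphism `ζ_B`, `zetaB_of` = [FrdI] Def. 1.3 (iii)(d));
* `prop42_iv_of_isDivisorial_of_unitRootsUpstairs` — the same from L05 `UnitRootsUpstairs` and the
  Def. 4.1 (iv)(e) reading `hE` (abc-iut-w4-d044's `zetaA_of_unitRootsUpstairs`);
* `prop42_iv_of_zetaA_treeCatVocab`, `prop42_iv_of_unitRootsUpstairs_treeCatVocab` — over the canonical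
  [FrdI] vocabulary (`Φ` divisorial = the structure field, `TemperedFrobenioid.isDivisorial_divisorMonoid`)
  the same with NO structural law and NO dictionary, for every setting and every transport.

So the node reading becomes: **(iv) AS TYPED, for every setting over the canonical vocabulary and every
transport, is open exactly modulo L06 `ZetaA`** (equivalently L05 + `hE`); at the free `(N,H)`-saturation
slot L05 keeps its named input `hL` (GAP-LEDGER G-w4d044-1).  HONEST FRAMING: refereed pre-IUT material;
typed ≠ proved for L05/L06; nothing here bears on or takes a side on [IUTchIII] Cor. 3.12.
-/

namespace Literature.AnabelianGeometry.EtaleTheta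

open CategoryTheory Opposite Literature.AlgebraicGeometry.Frobenioids

universe u₀ v₀ u v w

variable {K : Type u₀} [Field K]

namespace BiKummerSetting

namespace Prop42Sub

/-! ## §1. Arbitrary vocabulary: (iv) ⇐ ZetaA modulo `Φ` divisorial only -/

section General

variable {X : SemiGraphs.TemperedArithmeticGroup.{u₀} K} {D₀ : Type u₀} [Category.{v₀} D₀]
  {V : FrdIMonoidStub.{w}} {T : RealifiedDivisorMonoids (D₀ := D₀) V} {D : Type u} [Category.{v} D]
  {VD : FrdICatStub.{u, v, w} D} (S : BiKummerSetting X T D VD)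
  (pullFrac : ∀ {A A' : S.C} (_ : A' ⟶ A), S.biratUnits A → S.biratUnits A')

/-- **[EtTh] Prop. 4.2 (iv) AS TYPED ⇐ L06 `ZetaA`, modulo «`Φ` divisorial» ONLY — for every setting
(every [FrdI] vocabulary) and every transport**: L07′ is `rootUnitTorsion_holds`, L08 is a theorem, `B` is
group-like by `isUnit_BΛ`; no birational dictionary. [cite: MochizukiEtTh2009, Prop 4.2 p.89] -/
theorem prop42_iv_of_isDivisorial_of_zetaA
    (hΦd : Objectwise (fun M _ => IsDivisorial M) S.tf.divisorMonoid) (h₆ : ZetaA S pullFrac) :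
    S.Prop42_iv pullFrac :=
  prop42_iv_of_zetaA_of_rootUnitTorsion S pullFrac hΦd (S.tf.isGroupLike_ratFnFunctor T.isUnit_BΛ) h₆
    (rootUnitTorsion_holds S pullFrac)

/-- **[EtTh] Prop. 4.2 (iv) AS TYPED ⇐ L05 `UnitRootsUpstairs` + the Def. 4.1 (iv)(e) reading `hE`,
modulo «`Φ` divisorial» ONLY — for every setting and every transport** (L06 from L05 by abc-iut-w4-d044's
`zetaA_of_unitRootsUpstairs`). [cite: MochizukiEtTh2009, Prop 4.2 p.90] -/
theorem prop42_iv_of_isDivisorial_of_unitRootsUpstairs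
    (hΦd : Objectwise (fun M _ => IsDivisorial M) S.tf.divisorMonoid)
    (hE : ∀ {A B : S.C} (G : Subgroup (Aut A)) (α₂ : A ⟶ A) (α₁ : A ⟶ B),
      S.ArisesFromBaseFrobeniusPair G α₂ α₁ → S.tf.ArisesFromBaseFrobeniusPair G α₂ α₁)
    (h₅ : UnitRootsUpstairs S pullFrac) : S.Prop42_iv pullFrac :=
  prop42_iv_of_isDivisorial_of_zetaA S pullFrac hΦd
    (zetaA_of_unitRootsUpstairs S pullFrac hΦd (S.tf.isGroupLike_ratFnFunctor T.isUnit_BΛ) hE h₅)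

end General

/-! ## §2. Canonical vocabulary `treeCatVocab`: (iv) ⇐ ZetaA with no structural law and no dictionary -/

section TreeVocab

variable {X : SemiGraphs.TemperedArithmeticGroup.{u₀} K} {D₀ : Type u₀} [Category.{v₀} D₀]
  {V : FrdIMonoidStub.{w}} {T : RealifiedDivisorMonoids (D₀ := D₀) V} {D : Type u} [Category.{v} D]
  {IsRational IsStrictlyRational : (Dᵒᵖ ⥤ CommMonCat.{w}) → Prop}
  (S : BiKummerSetting X T D (treeCatVocab D IsRational IsStrictlyRational))
  (pullFrac : ∀ {A A' : S.C} (_ : A' ⟶ A), S.biratUnits A → S.biratUnits A')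

/-- **[EtTh] Prop. 4.2 (iv) AS TYPED ⇐ L06 `ZetaA` ALONE over the canonical [FrdI] vocabulary — every
setting, every transport, no other input.** [cite: MochizukiEtTh2009, Prop 4.2 p.89] -/
theorem prop42_iv_of_zetaA_treeCatVocab (h₆ : ZetaA S pullFrac) : S.Prop42_iv pullFrac :=
  prop42_iv_of_isDivisorial_of_zetaA S pullFrac S.tf.isDivisorial_divisorMonoid h₆

/-- **[EtTh] Prop. 4.2 (iv) AS TYPED ⇐ L05 `UnitRootsUpstairs` + `hE` over the canonical vocabulary —
every setting, every transport.** [cite: MochizukiEtTh2009, Prop 4.2 p.90] -/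
theorem prop42_iv_of_unitRootsUpstairs_treeCatVocab
    (hE : ∀ {A B : S.C} (G : Subgroup (Aut A)) (α₂ : A ⟶ A) (α₁ : A ⟶ B),
      S.ArisesFromBaseFrobeniusPair G α₂ α₁ → S.tf.ArisesFromBaseFrobeniusPair G α₂ α₁)
    (h₅ : UnitRootsUpstairs S pullFrac) : S.Prop42_iv pullFrac :=
  prop42_iv_of_isDivisorial_of_unitRootsUpstairs S pullFrac S.tf.isDivisorial_divisorMonoid hE h₅

end TreeVocab

end Prop42Sub

end BiKummerSetting

end Literature.AnabelianGeometry.EtaleTheta
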